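import Literature.Probability.Percolation.ClusterExplorationDecoupling
import Summits.CriticalPhenomena.PercolationContinuityZ3.Theses.PercShatteringRace

/-!
# Crux `PercShatteringRace.NearLinearTwoClusterDecay` (stmt-CriticalPhenomena-5785), line
# `first-cluster-exploration-independent-crossings-meet` — stub `stub_explorationBound`

Helper file for the crux skeleton of the line `first-cluster-exploration-independent-crossings-meet`
(lead prover-line-stmt-CriticalPhenomena-5785-1). Proves EXACTLY the registered stub signature
`stub_explorationBound`; lands with `--supports stmt-CriticalPhenomena-5785`.

## The statement (first-crossing-cluster exploration bound; every `p`, `N`, `R`)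

With `P_p = bondPercolation (zdGraph 3) p`, the open shell `T = Λ(R) ∖ Λ(N)`, sources
`A = Λ(N+1) ∖ Λ(N)` (inner layer) and targets `B = ∂ⁱⁿΛ(R)`:

`P_p(Sh) ≤ ∫ P_p({ω' | ∃ u ∈ A, v ∈ B, ω ∈ {u ⟷ v in T} ∧ ∃ u' ∈ A, v' ∈ B,
  ω' ∈ {u' ⟷ v' in T ∩ {w | ω ∉ {u ⟷ w in T}}}}) dP_p(ω)`,

where `Sh` = "two `T`-distinct open clusters each joining `A` to `B`".

## The argument (explore the source clusters until the first crossing one)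

All but the last declaration are general: `V` countable, any graph `Gr`, any `p`, a finite set `T`,
a target predicate `PB`, sources enumerated as `a 0, …, a (k-1)`.
1. `j⋆(ω)` = the least `j < k` whose source `a j` is joined to a `PB`-vertex inside `T` (`k` if
   none), `U(ω) = ⋃_{j ≤ j⋆} C_T(a j)` (the `T`-clusters explored up to and including the first
   crossing one), `N(ω)` = the pairs of `T` (`Finset.sym2`, diagonal included) with an endpoint in
   `U(ω)`; they enter through characterising hypotheses (`hjk`, `hjlt`, `hjat`, `hU`, `hNall`, style
   of `ClusterExplorationDecoupling.lean`) and are built (`Nat.find`, `Finset.filter`) in step 6 only.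
2. `isStoppingSet_nall`: agreement on `N(ω)` gives agreement on each single-source explored set of
   `a j`, `j ≤ j⋆(ω)`, hence (`ClusterExploration.openConnIn_iff_of_agree`) the same clusters
   `C_T(a j)`, `j ≤ j⋆(ω)`, the same first crossing index, the same `U`, the same `N`.
3. `diag_mem_nall_iff`: `s(w,w) ∈ N(ω) ↔ w ∈ U(ω)`, so the data event `A(F)` = "every pair of `F`
   touches `{w | s(w,w) ∈ F}` ∧ some source is joined to some target in `T ∖ {w | s(w,w) ∈ F}`"
   reads, at `F = N(ω)`, "a crossing of `T ∖ U(ω)`"; it is determined off `F`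
   (`exists_determinedBy_dataEvent`, the pattern of `ClusterExploration.exists_determinedBy_avoid`).
4. `mem_dataEvent_of_twoCrossings`: on `Sh` one of the two crossing sources is not joined inside `T`
   to `a j⋆` (else they would be joined); its crossing path avoids every `C_T(a j)`, `j ≤ j⋆`
   (`a j`, `j < j⋆`, does not cross): a crossing of `T ∖ U(ω)`.
5. `mem_avoidSection_of_mem_dataEvent`: a crossing of `T ∖ U(ω)` from a source `a i` forces
   `j⋆(ω) < i < k` (explored sources lie in `U(ω)`), so `u = a j⋆` crosses in `ω`, and
   `T ∖ U(ω) ⊆ T ∩ {w | ω ∉ {u ⟷ w in T}}`.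
6. `measure_twoCrossings_le_lintegral`: `measure_mono` (4), the tree's decoupling
   `ClusterExploration.measure_mem_dataEvent_eq_lintegral` (2, 3), `lintegral_mono` (5);
7. `stub_explorationBound`: `V = Site 3`, `T = box 3 R \ box 3 N` (`Finset.coe_sdiff`), sources
   enumerated by `(box 3 (N+1) \ box 3 N).toList`.

Tree API: `ClusterExploration.exists_explored`, `.openConnIn_iff_of_agree`,
`.measure_mem_dataEvent_eq_lintegral` (`ClusterExplorationDecoupling.lean`), `IsStoppingSet`,
`DeterminedBy`, `determinedBy_iff`, `DCT16.pathIn_of_mem_openConnIn`, `DCT16.mem_openConnIn_of_pathIn`,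
`DCT16.determinedBy_openConnIn`, `PathIn`. Mathlib: `Nat.find`, `Finset.sym2`, `Finset.coe_sdiff`,
`Finset.mem_toList`, `List.mem_iff_getElem`, `List.getD_eq_getElem`, `measure_mono`, `lintegral_mono`.
-/

noncomputable section

open MeasureTheory Filter Topology
open scoped ENNReal
open Literature.Probability.LatticeModels Literature.Probability.Percolation

namespace Summit.CriticalPhenomena.PercolationContinuityZ3.Theorems

namespace NearLinearTwoClusterDecayExploration

variable {V : Type*}

/-! ### Connections inside a set, off a forbidden set -/

/-- If every vertex joined to `y` inside `S` avoids `B`, then `{y ⟷ z in S} ⊆ {y ⟷ z in S ∖ B}`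
(the open path from `y` only visits vertices joined to `y` inside `S`). -/
theorem mem_openConnIn_diff {S B : Set V} {y z : V} {ω : BondConfig V}
    (h : ω ∈ openConnIn S y z) (hB : ∀ w, ω ∈ openConnIn S y w → w ∉ B) :
    ω ∈ openConnIn (S \ B) y z := by
  obtain ⟨hy, hr⟩ := DCT16.pathIn_of_mem_openConnIn h
  clear h
  refine DCT16.mem_openConnIn_of_pathIn
    ⟨⟨hy, hB y (DCT16.mem_openConnIn_of_pathIn (PathIn.refl hy))⟩, ?_⟩
  induction hr with
  | refl => exact Relation.ReflTransGen.refl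
  | @tail b c hyb hbc ih =>
    exact ih.tail ⟨hbc.1, hbc.2, hB c (DCT16.mem_openConnIn_of_pathIn ⟨hy, hyb.tail hbc⟩)⟩

/-! ### The first-crossing exploration of finitely many sources -/

section Exploration

/-!
Throughout this section: `T` is the finite ambient set, `PB` the target predicate, `a 0, …, a (k-1)`
the sources; `jstar ω` is the first crossing index (`hjk`, `hjlt`, `hjat`), `U ω` the union of the
`T`-clusters of `a j`, `j ≤ jstar ω` (`hU`), and `Nall ω` the pairs of `T` with an endpoint in `U ω`
(`hNall`).
-/

variable {T : Finset V} {PB : V → Prop} {a : ℕ → V} {k : ℕ} {jstar : BondConfig V → ℕ}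
  {U : BondConfig V → Set V} {Nall : BondConfig V → Finset (Sym2 V)}

/-- The explored pairs are pairs of `T`. -/
theorem nall_subset (hNall : ∀ ω f, f ∈ Nall ω ↔ (∀ b ∈ f, b ∈ T) ∧ ∃ b ∈ f, b ∈ U ω)
    (ω : BondConfig V) : Nall ω ⊆ T.sym2 :=
  fun _ hf => Finset.mem_sym2_iff.2 ((hNall ω _).1 hf).1

/-- The explored vertices lie in `T`. -/
theorem mem_of_mem_U (hU : ∀ ω w, w ∈ U ω ↔ ∃ j ≤ jstar ω, ω ∈ openConnIn (↑T : Set V) (a j) w)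
    {ω : BondConfig V} {w : V} (hw : w ∈ U ω) : w ∈ T := by
  obtain ⟨j, -, -, hwT, -⟩ := (hU ω w).1 hw
  exact hwT

/-- The diagonal pairs of the explored set recover the explored vertices:
`s(w, w) ∈ Nall ω ↔ w ∈ U ω`. -/
theorem diag_mem_nall_iff
    (hU : ∀ ω w, w ∈ U ω ↔ ∃ j ≤ jstar ω, ω ∈ openConnIn (↑T : Set V) (a j) w)
    (hNall : ∀ ω f, f ∈ Nall ω ↔ (∀ b ∈ f, b ∈ T) ∧ ∃ b ∈ f, b ∈ U ω) (ω : BondConfig V)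
    (w : V) : s(w, w) ∈ Nall ω ↔ w ∈ U ω := by
  rw [hNall]
  constructor
  · rintro ⟨-, b, hb, hbU⟩
    obtain rfl : b = w := by
      rcases Sym2.mem_iff.1 hb with h | h <;> exact h
    exact hbU
  · intro hw
    have hwT : w ∈ T := mem_of_mem_U hU hw
    refine ⟨fun b hb => ?_, w, Sym2.mem_mk_left w w, hw⟩
    rcases Sym2.mem_iff.1 hb with rfl | rfl <;> exact hwT

/-- Set form of `diag_mem_nall_iff`: `{w | s(w, w) ∈ Nall ω} = U ω`. -/
theorem setOf_diag_mem_nall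
    (hU : ∀ ω w, w ∈ U ω ↔ ∃ j ≤ jstar ω, ω ∈ openConnIn (↑T : Set V) (a j) w)
    (hNall : ∀ ω f, f ∈ Nall ω ↔ (∀ b ∈ f, b ∈ T) ∧ ∃ b ∈ f, b ∈ U ω) (ω : BondConfig V) :
    {w | s(w, w) ∈ Nall ω} = U ω :=
  Set.ext fun w => diag_mem_nall_iff hU hNall ω w

/-- The guard: every explored pair has an endpoint `b` whose diagonal pair `s(b, b)` is explored. -/
theorem guard_nall
    (hU : ∀ ω w, w ∈ U ω ↔ ∃ j ≤ jstar ω, ω ∈ openConnIn (↑T : Set V) (a j) w)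
    (hNall : ∀ ω f, f ∈ Nall ω ↔ (∀ b ∈ f, b ∈ T) ∧ ∃ b ∈ f, b ∈ U ω) (ω : BondConfig V) :
    ∀ f ∈ Nall ω, ∃ b ∈ f, s(b, b) ∈ Nall ω := by
  intro f hf
  obtain ⟨-, b, hb, hbU⟩ := (hNall ω f).1 hf
  exact ⟨b, hb, (diag_mem_nall_iff hU hNall ω b).2 hbU⟩

/-- **The first-crossing exploration is a stopping set of pairs**: configurations agreeing on the
explored pairs explore the same pairs (same clusters `C_T(a j)`, `j ≤ j⋆`, by the single-source
`ClusterExploration.openConnIn_iff_of_agree`; hence the same first crossing index, the same `U`). -/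
theorem isStoppingSet_nall (hjk : ∀ ω, jstar ω ≤ k)
    (hjlt : ∀ ω j, j < jstar ω → ¬∃ v, PB v ∧ ω ∈ openConnIn (↑T : Set V) (a j) v)
    (hjat : ∀ ω, jstar ω < k → ∃ v, PB v ∧ ω ∈ openConnIn (↑T : Set V) (a (jstar ω)) v)
    (hU : ∀ ω w, w ∈ U ω ↔ ∃ j ≤ jstar ω, ω ∈ openConnIn (↑T : Set V) (a j) w)
    (hNall : ∀ ω f, f ∈ Nall ω ↔ (∀ b ∈ f, b ∈ T) ∧ ∃ b ∈ f, b ∈ U ω) :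
    IsStoppingSet Nall := by
  intro ω ω' hag
  have hcl : ∀ j ≤ jstar ω, ∀ w, ω ∈ openConnIn (↑T : Set V) (a j) w ↔
      ω' ∈ openConnIn (↑T : Set V) (a j) w := by
    intro j hj w
    obtain ⟨Nx, hNx⟩ := ClusterExploration.exists_explored T (a j)
    refine ClusterExploration.openConnIn_iff_of_agree hNx (fun f hf => hag f ?_) w
    obtain ⟨hfT, b, hb, hbω⟩ := (hNx ω f).1 hf
    exact (hNall ω f).2 ⟨hfT, b, hb, (hU ω b).2 ⟨j, hj, hbω⟩⟩
  have hjs : jstar ω' = jstar ω := by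
    by_contra hne
    rcases lt_or_gt_of_ne hne with hlt | hgt
    · obtain ⟨v, hv, hv'⟩ := hjat ω' (lt_of_lt_of_le hlt (hjk ω))
      exact hjlt ω _ hlt ⟨v, hv, (hcl _ hlt.le v).2 hv'⟩
    · obtain ⟨v, hv, hvω⟩ := hjat ω (lt_of_lt_of_le hgt (hjk ω'))
      exact hjlt ω' _ hgt ⟨v, hv, (hcl _ le_rfl v).1 hvω⟩
  have hUeq : ∀ w, w ∈ U ω' ↔ w ∈ U ω := fun w => by
    rw [hU, hU, hjs]
    exact exists_congr fun j => and_congr_right fun hj => (hcl j hj w).symm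
  ext f
  rw [hNall, hNall]
  exact and_congr_right fun _ => exists_congr fun b => and_congr_right fun _ => hUeq b

/-- **Two `T`-distinct crossing clusters give a crossing off the explored vertices.** On the
two-cluster event, one of the two crossing sources is not joined inside `T` to `a j⋆` (else the two
sources would be joined), and its crossing path avoids `U ω`: a vertex of it in `C_T(a j)` would join
the source to `a j⋆` (`j = j⋆`) or make `a j` cross (`j < j⋆`). With the guard, this is membership
in the data event at `F = Nall ω`. -/
theorem mem_dataEvent_of_twoCrossings
    (hjlt : ∀ ω j, j < jstar ω → ¬∃ v, PB v ∧ ω ∈ openConnIn (↑T : Set V) (a j) v)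
    (hU : ∀ ω w, w ∈ U ω ↔ ∃ j ≤ jstar ω, ω ∈ openConnIn (↑T : Set V) (a j) w)
    (hNall : ∀ ω f, f ∈ Nall ω ↔ (∀ b ∈ f, b ∈ T) ∧ ∃ b ∈ f, b ∈ U ω) {PA : V → Prop}
    {ω : BondConfig V}
    (hω : ∃ u, PA u ∧ ∃ u', PA u' ∧ ∃ v, PB v ∧ ∃ v', PB v' ∧
      ω ∈ openConnIn (↑T : Set V) u v ∧ ω ∈ openConnIn (↑T : Set V) u' v' ∧
      ω ∉ openConnIn (↑T : Set V) u u') :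
    (∀ f ∈ Nall ω, ∃ b ∈ f, s(b, b) ∈ Nall ω) ∧
      ∃ u', PA u' ∧ ∃ v', PB v' ∧ ω ∈ openConnIn (↑T \ {w | s(w, w) ∈ Nall ω}) u' v' := by
  obtain ⟨u, hu, u', hu', v, hv, v', hv', huv, hu'v', hne⟩ := hω
  refine ⟨guard_nall hU hNall ω, ?_⟩
  rw [setOf_diag_mem_nall hU hNall ω]
  have key : ∀ y z, PA y → PB z → ω ∈ openConnIn (↑T : Set V) y z →
      ω ∉ openConnIn (↑T : Set V) (a (jstar ω)) y →
      ∃ u', PA u' ∧ ∃ v', PB v' ∧ ω ∈ openConnIn (↑T \ U ω) u' v' := by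
    intro y z hy hz hyz hny
    refine ⟨y, hy, z, hz, mem_openConnIn_diff hyz fun w hyw hwU => ?_⟩
    obtain ⟨j, hj, haj, hwT, hjw⟩ := (hU ω w).1 hwU
    obtain ⟨hyT, _, hyw'⟩ := hyw
    rcases hj.lt_or_eq with hlt | rfl
    · obtain ⟨_, hzT, hyz'⟩ := hyz
      exact hjlt ω j hlt ⟨z, hz, haj, hzT, (hjw.trans hyw'.symm).trans hyz'⟩
    · exact hny ⟨haj, hyT, hjw.trans hyw'.symm⟩
  by_cases hcu : ω ∈ openConnIn (↑T : Set V) (a (jstar ω)) u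
  · obtain ⟨haT, huT, hr⟩ := hcu
    exact key u' v' hu' hv' hu'v' fun ⟨_, hu'T, hr'⟩ => hne ⟨huT, hu'T, hr.symm.trans hr'⟩
  · exact key u v hu hv huv hcu

/-- **The data event is contained in the `ω`-section of the avoidable pair.** A crossing of
`T ∖ U ω` from a source `a i` forces `j⋆(ω) < i < k` (explored sources lie in `U ω`), so the source
`a j⋆` crosses in `ω`, and `T ∖ U ω ⊆ T ∩ {w | ω ∉ {a j⋆ ⟷ w in T}}`. -/
theorem mem_avoidSection_of_mem_dataEvent
    (hjat : ∀ ω, jstar ω < k → ∃ v, PB v ∧ ω ∈ openConnIn (↑T : Set V) (a (jstar ω)) v)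
    (hU : ∀ ω w, w ∈ U ω ↔ ∃ j ≤ jstar ω, ω ∈ openConnIn (↑T : Set V) (a j) w)
    (hNall : ∀ ω f, f ∈ Nall ω ↔ (∀ b ∈ f, b ∈ T) ∧ ∃ b ∈ f, b ∈ U ω) {PA : V → Prop}
    (hAL : ∀ u, PA u ↔ ∃ i < k, a i = u) {ω ω' : BondConfig V}
    (h : ∃ u', PA u' ∧ ∃ v', PB v' ∧ ω' ∈ openConnIn (↑T \ {w | s(w, w) ∈ Nall ω}) u' v') :
    ∃ u, PA u ∧ ∃ v, PB v ∧ ω ∈ openConnIn (↑T : Set V) u v ∧ ∃ u', PA u' ∧ ∃ v', PB v' ∧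
      ω' ∈ openConnIn (↑T ∩ {w | ω ∉ openConnIn (↑T : Set V) u w}) u' v' := by
  rw [setOf_diag_mem_nall hU hNall ω] at h
  obtain ⟨u', hu', v', hv', h'⟩ := h
  obtain ⟨i, hik, rfl⟩ := (hAL u').1 hu'
  have hmem : a i ∈ (↑T : Set V) \ U ω := h'.1
  have hji : jstar ω < i := by
    by_contra hle
    exact hmem.2 ((hU ω _).2 ⟨i, not_lt.1 hle, hmem.1, hmem.1, SimpleGraph.Reachable.refl _⟩)
  obtain ⟨v₀, hv₀, h₀⟩ := hjat ω (hji.trans hik)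
  have hsub : (↑T : Set V) \ U ω ⊆ ↑T ∩ {w | ω ∉ openConnIn (↑T : Set V) (a (jstar ω)) w} :=
    fun w hw => ⟨hw.1, fun hw' => hw.2 ((hU ω w).2 ⟨jstar ω, le_rfl, hw'⟩)⟩
  exact ⟨a (jstar ω), (hAL _).2 ⟨jstar ω, hji.trans hik, rfl⟩, v₀, hv₀, h₀, a i, hu', v', hv',
    DCT16.mem_openConnIn_of_pathIn ((DCT16.pathIn_of_mem_openConnIn h').mono hsub)⟩

end Exploration

/-! ### The data event is determined off the explored pairs -/

/-- The data event "every pair of `F` has an endpoint `b` with `s(b, b) ∈ F` (guard), and some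
source is joined to some target inside `T ∖ {w | s(w, w) ∈ F}`" is determined by a finite set of
pairs disjoint from `F` (the pairs of `T ∖ {w | s(w, w) ∈ F}` when the guard holds, `∅` otherwise). -/
theorem exists_determinedBy_dataEvent (T : Finset V) (PA PB : V → Prop) (F : Finset (Sym2 V)) :
    ∃ H : Finset (Sym2 V), Disjoint F H ∧ DeterminedBy {ω' : BondConfig V |
      (∀ f ∈ F, ∃ b ∈ f, s(b, b) ∈ F) ∧
        ∃ u', PA u' ∧ ∃ v', PB v' ∧ ω' ∈ openConnIn (↑T \ {w | s(w, w) ∈ F}) u' v'} ↑H := by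
  classical
  set W : Set V := {w | s(w, w) ∈ F} with hW
  by_cases hg : ∀ f ∈ F, ∃ b ∈ f, s(b, b) ∈ F
  · refine ⟨(T.filter (· ∉ W)).sym2, ?_, ?_⟩
    · rw [Finset.disjoint_left]
      intro f hfF hfH
      obtain ⟨b, hbf, hb⟩ := hg f hfF
      exact (Finset.mem_filter.1 (Finset.mem_sym2_iff.1 hfH b hbf)).2 hb
    · have hK : ((↑T : Set V) \ W).sym2 ⊆ ↑((T.filter (· ∉ W)).sym2) := by
        rw [Finset.coe_sym2, Finset.coe_filter]
        rintro z hz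
        induction z using Sym2.ind with
        | h x y =>
          rw [Set.mk_mem_sym2_iff] at hz ⊢
          exact ⟨⟨hz.1.1, hz.1.2⟩, ⟨hz.2.1, hz.2.2⟩⟩
      rw [determinedBy_iff]
      intro ω ω' h
      simp only [Set.mem_setOf_eq]
      refine and_congr_right fun _ => exists_congr fun u' => and_congr_right fun _ =>
        exists_congr fun v' => and_congr_right fun _ => ?_
      exact (determinedBy_iff _ _).1 (DCT16.determinedBy_openConnIn _ u' v' hK) ω ω' h
  · refine ⟨∅, Finset.disjoint_empty_right _, ?_⟩
    rw [determinedBy_iff]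
    intro ω ω' _
    simp only [Set.mem_setOf_eq]
    exact ⟨fun h => absurd h.1 hg, fun h => absurd h.1 hg⟩

/-! ### Assembly: the abstract exploration bound -/

/-- **First-crossing-cluster exploration bound (abstract).** For a countable vertex type, any graph
`Gr`, any `p`, a finite set `S = ↑T`, sources `PA` enumerated by `a 0, …, a (k-1)` and targets `PB`:
`P_p(two S-distinct open clusters from PA to PB) ≤
  ∫ P_p({ω' | ∃ u (PA), v (PB), ω ∈ {u ⟷ v in S} ∧ ∃ u' (PA), v' (PB),
    ω' ∈ {u' ⟷ v' in S ∩ {w | ω ∉ {u ⟷ w in S}}}}) dP_p(ω)`. -/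
theorem measure_twoCrossings_le_lintegral [Countable V] (Gr : SimpleGraph V) (p : unitInterval)
    (T : Finset V) {S : Set V} (hST : S = ↑T) (PA PB : V → Prop) (a : ℕ → V) (k : ℕ)
    (hAL : ∀ u, PA u ↔ ∃ i < k, a i = u) :
    bondPercolation Gr p {ω | ∃ u, PA u ∧ ∃ u', PA u' ∧ ∃ v, PB v ∧ ∃ v', PB v' ∧
        ω ∈ openConnIn S u v ∧ ω ∈ openConnIn S u' v' ∧ ω ∉ openConnIn S u u'} ≤
      ∫⁻ ω, bondPercolation Gr p {ω' | ∃ u, PA u ∧ ∃ v, PB v ∧ ω ∈ openConnIn S u v ∧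
          ∃ u', PA u' ∧ ∃ v', PB v' ∧
            ω' ∈ openConnIn (S ∩ {w | ω ∉ openConnIn S u w}) u' v'}
        ∂(bondPercolation Gr p) := by
  classical
  subst hST
  -- the first crossing index `jstar`, through its characterisation
  have hex : ∀ ω : BondConfig V, ∃ j, k ≤ j ∨ ∃ v, PB v ∧ ω ∈ openConnIn (↑T : Set V) (a j) v :=
    fun ω => ⟨k, Or.inl le_rfl⟩
  obtain ⟨jstar, hjk, hjlt, hjat⟩ : ∃ jstar : BondConfig V → ℕ, (∀ ω, jstar ω ≤ k) ∧
      (∀ ω j, j < jstar ω → ¬∃ v, PB v ∧ ω ∈ openConnIn (↑T : Set V) (a j) v) ∧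
      (∀ ω, jstar ω < k → ∃ v, PB v ∧ ω ∈ openConnIn (↑T : Set V) (a (jstar ω)) v) :=
    ⟨fun ω => Nat.find (hex ω), fun ω => Nat.find_le (Or.inl le_rfl),
      fun ω j hj h => Nat.find_min (hex ω) hj (Or.inr h),
      fun ω hlt => (Nat.find_spec (hex ω)).resolve_left (not_le.2 hlt)⟩
  -- the explored vertices `U` and the explored pairs `Nall`, through their characterisations
  obtain ⟨U, hU⟩ : ∃ U : BondConfig V → Set V,
      ∀ ω w, w ∈ U ω ↔ ∃ j ≤ jstar ω, ω ∈ openConnIn (↑T : Set V) (a j) w :=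
    ⟨fun ω => {w | ∃ j ≤ jstar ω, ω ∈ openConnIn (↑T : Set V) (a j) w}, fun ω w => Iff.rfl⟩
  obtain ⟨Nall, hNall⟩ : ∃ Nall : BondConfig V → Finset (Sym2 V),
      ∀ ω f, f ∈ Nall ω ↔ (∀ b ∈ f, b ∈ T) ∧ ∃ b ∈ f, b ∈ U ω :=
    ⟨fun ω => T.sym2.filter fun f => ∃ b ∈ f, b ∈ U ω, fun ω f => by
      rw [Finset.mem_filter, Finset.mem_sym2_iff]⟩
  -- decoupling along the stopping set `Nall`
  have key := ClusterExploration.measure_mem_dataEvent_eq_lintegral Gr p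
    (isStoppingSet_nall hjk hjlt hjat hU hNall) (nall_subset hNall)
    (fun F _ => {ω' : BondConfig V | (∀ f ∈ F, ∃ b ∈ f, s(b, b) ∈ F) ∧
      ∃ u', PA u' ∧ ∃ v', PB v' ∧ ω' ∈ openConnIn (↑T \ {w | s(w, w) ∈ F}) u' v'})
    fun F _ => exists_determinedBy_dataEvent T PA PB F
  refine (measure_mono fun ω hω => ?_).trans
    (key.le.trans (lintegral_mono fun ω => measure_mono fun ω' hω' => ?_))
  · exact mem_dataEvent_of_twoCrossings hjlt hU hNall hω
  · obtain ⟨-, h⟩ := hω'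
    exact mem_avoidSection_of_mem_dataEvent hjat hU hNall hAL h

end NearLinearTwoClusterDecayExploration

/-- **Stub `stub_explorationBound` (first-crossing-cluster exploration bound; every `p`, `N`, `R`).**
For bond percolation on `ℤ³`, with `T = Λ(R) ∖ Λ(N)`, inner layer `A = Λ(N+1) ∖ Λ(N)` and
`B = ∂ⁱⁿΛ(R)`: `P_p(Sh(N, R)) ≤ ∫ P_p(AvoidSection_{N,R}(ω)) dP_p(ω)`, where `Sh(N, R)` = "two
`T`-distinct open clusters from `A` to `B`" and `AvoidSection(ω)` = "for some `u ∈ A` joined inside `T`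
to `B` in `ω`, the fresh configuration `ω'` has a crossing of `T` from `A` to `B` avoiding the vertex
set of the `ω`-`T`-cluster of `u`". Proof: `NearLinearTwoClusterDecayExploration.measure_twoCrossings_le_lintegral`
(explore the `T`-clusters of the sources in a fixed order until the first crossing one — a stopping
set of pairs; a second, `T`-distinct crossing cluster lives on the unexplored pairs, which are fresh
by the tree's `ClusterExploration.measure_mem_dataEvent_eq_lintegral`) at `V = Site 3`,
`T = box 3 R \ box 3 N`, sources enumerated by `(box 3 (N+1) \ box 3 N).toList`. -/
theorem stub_explorationBound :
    ∀ (p : unitInterval) (N R : ℕ),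
      bondPercolation (zdGraph 3) p
          {ω : BondConfig (Site 3) |
            ∃ u ∈ (↑(box 3 (N + 1)) : Set (Site 3)) \ ↑(box 3 N),
            ∃ u' ∈ (↑(box 3 (N + 1)) : Set (Site 3)) \ ↑(box 3 N),
            ∃ v ∈ innerBoundary (zdGraph 3) (box 3 R),
            ∃ v' ∈ innerBoundary (zdGraph 3) (box 3 R),
              ω ∈ openConnIn ((↑(box 3 R) : Set (Site 3)) \ ↑(box 3 N)) u v ∧
              ω ∈ openConnIn ((↑(box 3 R) : Set (Site 3)) \ ↑(box 3 N)) u' v' ∧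
              ω ∉ openConnIn ((↑(box 3 R) : Set (Site 3)) \ ↑(box 3 N)) u u'} ≤
        ∫⁻ ω, bondPercolation (zdGraph 3) p
          {ω' : BondConfig (Site 3) |
            ∃ u ∈ (↑(box 3 (N + 1)) : Set (Site 3)) \ ↑(box 3 N),
            ∃ v ∈ innerBoundary (zdGraph 3) (box 3 R),
              ω ∈ openConnIn ((↑(box 3 R) : Set (Site 3)) \ ↑(box 3 N)) u v ∧
              ∃ u' ∈ (↑(box 3 (N + 1)) : Set (Site 3)) \ ↑(box 3 N),
              ∃ v' ∈ innerBoundary (zdGraph 3) (box 3 R),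
                ω' ∈ openConnIn ((((↑(box 3 R) : Set (Site 3)) \ ↑(box 3 N))) ∩
                  {w : Site 3 | ω ∉ openConnIn ((↑(box 3 R) : Set (Site 3)) \ ↑(box 3 N)) u w}) u' v'}
          ∂(bondPercolation (zdGraph 3) p) := by
  intro p N R
  have hAL : ∀ u : Site 3, u ∈ (↑(box 3 (N + 1)) : Set (Site 3)) \ ↑(box 3 N) ↔
      ∃ i < ((box 3 (N + 1) \ box 3 N).toList).length,
        ((box 3 (N + 1) \ box 3 N).toList).getD i 0 = u := by
    intro u
    rw [Set.mem_sdiff, Finset.mem_coe, Finset.mem_coe, ← Finset.mem_sdiff, ← Finset.mem_toList,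
      List.mem_iff_getElem]
    constructor
    · rintro ⟨i, hi, rfl⟩
      exact ⟨i, hi, List.getD_eq_getElem _ _ hi⟩
    · rintro ⟨i, hi, rfl⟩
      exact ⟨i, hi, (List.getD_eq_getElem _ _ hi).symm⟩
  exact NearLinearTwoClusterDecayExploration.measure_twoCrossings_le_lintegral (zdGraph 3) p
    (box 3 R \ box 3 N) (Finset.coe_sdiff (box 3 R) (box 3 N)).symm
    (fun u => u ∈ (↑(box 3 (N + 1)) : Set (Site 3)) \ ↑(box 3 N))
    (fun v => v ∈ innerBoundary (zdGraph 3) (box 3 R))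
    (fun i => ((box 3 (N + 1) \ box 3 N).toList).getD i 0) _ hAL

end Summit.CriticalPhenomena.PercolationContinuityZ3.Theorems

end
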